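import Summits.HodgeConjecture.HodgeConjecture.Theorems.K2LiuArchSchwartzTensorDense
import Summits.HodgeConjecture.HodgeConjecture.Theorems.K2LiuPureTensorWitness
import Summits.HodgeConjecture.HodgeConjecture.Theorems.K2LiuDoubledLiftSpanReduction
import Summits.HodgeConjecture.HodgeConjecture.Theorems.K2LiuConjugateSymplecticInv
import HarnessLib

/-!
# TENSOR SEPARATION FOR THE DOUBLING PAIRING — socket #45D `sig_K2LiuDoublingPairingTensorSeparation` (U6 ED. 7) PROVED

Track B ∕ hLiu418 = stmt-HodgeConjecture-24832, line `K2_Liu_CurveThetaSigs`, unit U6 `Cruxes/HLiu418/Lines/K2_Liu_CurveThetaSigs_U6_FirstTerm.lean` (ED. 7,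
tree 996734da63aee076 :428–:508), socket #45D ((O45ii) as a socket; LEAD F0P6-plan re-deal 2026-09-04 02:36Z); seat `hodgecm-mathlib-K2Liu-p03` (g3).
The theorem below has, token for token, the type of the socket (only `IdeleClassGroup L` spelled `Literature.NumberTheory.Automorphic.IdeleClassGroup L`, the
same constant): **if the doubling pairing `𝒫(Φ′) = ⟨⟨Θ̃^□_{Φ′}(f)(ι(ιA ·, ιA ·)), w₁ ⊗ w̄₂⟩⟩_{[G]²}` is non-zero for SOME `Φ′ ∈ 𝒮(𝔸^{n″})`, it is non-zero for
some `Φ″` in the `ℂ`-span of the pure tensors `Φ₁ ⊠_ι Φ₂`, `ι = idxSplit e₂ e₁ e₁`** (same line `⟨a′⟩`, same `μ_W`, same weight `f`; in fact `Φ″` is itself a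
pure tensor).

PROOF.  `Φ ↦ 𝒫(Φ)` is `ℂ`-linear (★ `K2LiuDoubledLiftSpanReduction.doublingPairing_doubledLineThetaLift_add_smul`) and continuous on every archimedean slot
`φ ↦ 𝒫(φ ⊗ Φ_f)` for the Schwartz topology (★ g2 `K2LiuDoubledThetaPairingContinuous.continuous_doublingPairing_doubledLineThetaLift_of_slot`, Weil's
Théorème 6 in `Φ`, along the LF-continuous slots ★ `continuous_thetaDistLM_comp_tmul_of_isLFContinuous`); the separate-variable products are dense in the
archimedean Schwartz space (★ `K2LiuArchSchwartzTensorDense.dense_span_archBoxTensor` — Hermite expansion [ReedSimon I Thm V.13] + Hermite functions of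
the juxtaposed frame are products [Folland1989 §1.7]); hence a non-zero `𝒫` is non-zero on some pure tensor (★ `K2LiuPureTensorWitness.exists_sumTensor_ne_zero`:
finite places are an algebraic tensor product, ★ `AdelicSchwartzBruhatDirectSumSpan`), which lies in the span.

No definition, no instance, no named fact, no `sorry`; axioms ⊆ {propext, Classical.choice, Quot.sound}.

## References
* [ReedSimonI1980] M. Reed, B. Simon, *Methods of Modern Mathematical Physics I*, Thm. V.13 (the `N`-representation of `𝒮`).
* [Treves1967] F. Trèves, *Topological Vector Spaces, Distributions and Kernels*, Thm. 51.6 p. 530.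
* [Folland1989] G. B. Folland, *Harmonic Analysis in Phase Space*, §1.7 (1.81).
* [HarrisKudlaSweet1996] M. Harris, S. Kudla, W. J. Sweet, J. AMS 9 (1996), §1 proof of Lem. 1.1, §6.
* [Weil1964] A. Weil, Acta Math. 111 (1964), Chap. I n° 11, n° 29; Chap. III n° 41 Thm 6.
* [Liu2021] Y. Liu, Camb. J. Math. 9 (2021), proof of Thm. 4.15; App. B Lem. B.9–B.11.

HONEST LABEL: HC_CM is proved only modulo the 7 printed citations (2 remaining named inputs: hLiu418 = stmt-HodgeConjecture-24832, h413 =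
stmt-HodgeConjecture-24833) until rung 0 closes; this file pays one socket of the U6 line and moves no counter by itself.
-/

set_option autoImplicit false

set_option linter.dupNamespace false

noncomputable section

open scoped Matrix Topology TensorProduct SchwartzMap Classical
open NumberField NumberField.mixedEmbedding IsDedekindDomain MeasureTheory Filter

namespace Summit.HodgeConjecture.HodgeConjecture.Cruxes.HLiu418.K2LiuDoublingPairingTensorSeparation

open Literature.NumberTheory.Automorphic Literature.NumberTheory.GaloisRepresentations
open Literature.NumberTheory.GelbartRogawski1991 Literature.NumberTheory.GelbartRogawski1991.GRConstruction
open Literature.NumberTheory.K2Lit.SiegelDoubled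
open Literature.NumberTheory.Automorphic.UnitaryGroup (adelicGroupData adelicVal)
open Literature.NumberTheory.Automorphic.UnitaryGroup.CotangentForms (toQuotFun)
open Literature.NumberTheory.Automorphic.IdeleClassGroup
open Literature.NumberTheory.Automorphic.Liu2021
open Literature.NumberTheory.Automorphic.Liu2021.Def411WeilCarriers
open Literature.NumberTheory.Automorphic.Liu2021.Def411WeilCarriersDoubling
open Literature.NumberTheory.GelbartRogawski1991.UnitaryDualPair
open Literature.NumberTheory.Weil1964
open Literature.RepresentationTheory.Liu2021
open Literature.RepresentationTheory.HeisenbergGroup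
open Literature.NumberTheory.K2Lit.DoubledLineTheta
open Summit.HodgeConjecture.HodgeConjecture.Cruxes.HLiu418
open Summit.HodgeConjecture.HodgeConjecture.Cruxes.HLiu418.K2LiuDoubledLiftSpanReduction
open Summit.HodgeConjecture.HodgeConjecture.Cruxes.HLiu418.K2LiuDoubledThetaPairingContinuous
open Summit.HodgeConjecture.HodgeConjecture.Cruxes.HLiu418.K2LiuPureTensorWitness
open Summit.HodgeConjecture.HodgeConjecture.Cruxes.HLiu418.K2LiuArchSchwartzTensorDense

/-! ## §1 Continuity of the pairing on every archimedean slot (the `f`-general twin of ★ `continuous_doublingPairing_doubledLineThetaIntegral_tmul`) -/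

section Slot

variable (L : Type) [Field L] [NumberField L] [IsCMField L]
variable {N n : ℕ} (e : Fin N × Fin 1 ≃ Fin n) (H : Matrix (Fin N) (Fin N) L)
  (dV : Fin N → L) (hdV : ∀ i, IsCMField.complexConj L (dV i) = dV i)
  (dW : Fin 1 → L) (hdW : ∀ i, IsCMField.complexConj L (dW i) = dW i)
  {n'' : ℕ} (e₁ : Fin (n + n) × Fin 1 ≃ Fin n'')
  (hdV0 : ∀ i, dV i ≠ 0) (hdW0 : ∀ i, dW i ≠ 0)
  (lam : Literature.NumberTheory.Automorphic.IdeleClassGroup L →ₜ* Circle) (hlam : IsConjugateSymplectic L lam) (a' : (Fp L)ˣ)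
  (hρ : HasThetaMajorants fun
      (p : ↥(UnitaryGroup.adelic (Fp L) L (IsCMField.complexConj L) (n + n) (Matrix.diagonal (dD L e dV hdV dW hdW))) ×
        ↥(UnitaryGroup.adelic (Fp L) L (IsCMField.complexConj L) 1 (JW (Fp L) L a')))
      (Φ : piSchwartzBruhat (Fp L) (Fin n'')) =>
        pairRep (Fp L) L (IsCMField.complexConj L) (n + n) 1 e₁ (Matrix.diagonal (dD L e dV hdV dW hdW)) (JW (Fp L) L a')
          (chiSplittingLine L e₁ (dD L e dV hdV dW hdW) (dD_conj L e dV hdV dW hdW) (dD_ne_zero L e dV hdV dW hdW hdV0 hdW0)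
            (toHeckeCharacter L lam) (isUnitary_toHeckeCharacter L lam)
            ((isOscillatorChar_toHeckeCharacter_iff lam).mpr hlam) (TW (Fp L) a')
            (isUnit_det_TW (Fp L) a') (JW (Fp L) L a') (JW_eq (Fp L) L a'))
          p Φ)
  (ιA : (adelicGroupData (Fp L) L (IsCMField.complexConj L) N H).Adelic →*
    ↥(UnitaryGroup.adelic (Fp L) L (IsCMField.complexConj L) N (Matrix.diagonal dV)))
  (hιAc : Continuous ιA)
  (hιAr : ∀ ⦃γ : (adelicGroupData (Fp L) L (IsCMField.complexConj L) N H).Adelic⦄,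
    γ ∈ (UnitaryGroup.toAdelic (Fp L) L (IsCMField.complexConj L) N H).range →
      ιA γ ∈ (UnitaryGroup.toAdelic (Fp L) L (IsCMField.complexConj L) N (Matrix.diagonal dV)).range)
  [MeasurableSpace (↥(UnitaryGroup.adelic (Fp L) L (IsCMField.complexConj L) 1 (JW (Fp L) L a')) ⧸
    (UnitaryGroup.toAdelic (Fp L) L (IsCMField.complexConj L) 1 (JW (Fp L) L a')).range)]
  [BorelSpace (↥(UnitaryGroup.adelic (Fp L) L (IsCMField.complexConj L) 1 (JW (Fp L) L a')) ⧸
    (UnitaryGroup.toAdelic (Fp L) L (IsCMField.complexConj L) 1 (JW (Fp L) L a')).range)]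
  (μW : Measure (↥(UnitaryGroup.adelic (Fp L) L (IsCMField.complexConj L) 1 (JW (Fp L) L a')) ⧸
    (UnitaryGroup.toAdelic (Fp L) L (IsCMField.complexConj L) 1 (JW (Fp L) L a')).range)) [IsFiniteMeasure μW]
  (f : C(↥(UnitaryGroup.adelic (Fp L) L (IsCMField.complexConj L) 1 (JW (Fp L) L a')) ⧸
    (UnitaryGroup.toAdelic (Fp L) L (IsCMField.complexConj L) 1 (JW (Fp L) L a')).range, ℂ))

include hιAc hιAr in
/-- **The doubling pairing of the doubled line-theta LIFT is continuous on every archimedean slot** `φ ↦ 𝒫(φ ⊗ Φ_f)` (Schwartz topology on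
`𝓢((F ⊗ ℝ)^{n″})`, `Φ_f` fixed; `[G]` compact, `w₁, w₂ ∈ L¹(μ)`, any weight `f`) — ★ `continuous_doublingPairing_doubledLineThetaLift_of_slot` along the LF-continuous
slots (★ `adelicMpCont.isLFContinuous_omega`, ★ `continuous_thetaDistLM_comp_tmul_of_isLFContinuous`; `𝓢` barrelled, ★ `barrelledSpace_schwartzMap`).
[cite: HarrisKudlaSweet1996, §1 proof of Lem. 1.1] [cite: Weil1964, Chap. I n° 11; Chap. III n° 41 Thm 6 p. 193] -/
theorem continuous_doublingPairing_doubledLineThetaLift_tmul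
    [CompactSpace (adelicGroupData (Fp L) L (IsCMField.complexConj L) N H).automorphicQuotient]
    (μ : Measure (adelicGroupData (Fp L) L (IsCMField.complexConj L) N H).automorphicQuotient)
    {w₁ w₂ : (adelicGroupData (Fp L) L (IsCMField.complexConj L) N H).automorphicQuotient → ℂ}
    (hw₁ : Integrable w₁ μ) (hw₂ : Integrable w₂ μ) (Φf : FinSB (Fp L) (Fin n'')) :
    Continuous fun φ : 𝓢((Fin n'' → mixedSpace (Fp L)), ℂ) =>
      doublingPairing (adelicGroupData (Fp L) L (IsCMField.complexConj L) N H) μ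
        (toQuotFun₂ (adelicGroupData (Fp L) L (IsCMField.complexConj L) N H)
          (fun g => doubledLineThetaLift L e dV hdV dW hdW e₁ hdV0 hdW0 lam hlam a' hρ μW
            (piSchwartzBruhatEquiv (Fp L) (Fin n'') (φ ⊗ₜ[ℂ] Φf)) f (iotaV L e dV hdV dW hdW (ιA g.1, ιA g.2))))
        w₁ w₂ := by
  haveI : BarrelledSpace ℂ 𝓢((Fin n'' → mixedSpace (Fp L)), ℂ) := Literature.Analysis.FunctionSpaces.barrelledSpace_schwartzMap
  have h := continuous_doublingPairing_doubledLineThetaLift_of_slot L e H dV hdV dW hdW e₁ hdV0 hdW0 lam hlam a' hρ ιA hιAc hιAr μW f μ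
    hw₁ hw₂ ((piSchwartzBruhatEquiv (Fp L) (Fin n'')).toLinearMap ∘ₗ
      (TensorProduct.mk ℂ 𝓢((Fin n'' → mixedSpace (Fp L)), ℂ) (FinSB (Fp L) (Fin n''))).flip Φf)
    fun p => continuous_thetaDistLM_comp_tmul_of_isLFContinuous (adelicMpCont.isLFContinuous_omega _) Φf
  exact h.congr fun φ => rfl

end Slot

/-! ## §2 The socket -/

/-- **TENSOR SEPARATION FOR THE DOUBLING PAIRING** (socket #45D, ED. 7 bytes): a non-zero doubled theta pairing at SOME Schwartz–Bruhat datum `Φ′` forces a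
non-zero pairing at some `Φ″` in the `ℂ`-span of the pure tensors `Φ₁ ⊠_ι Φ₂` (`ι = idxSplit e₂ e₁ e₁`), on the same line, with the same `μ_W` and weight `f`.
[cite: ReedSimonI1980, Thm. V.13] [cite: Treves1967, Thm. 51.6] [cite: HarrisKudlaSweet1996, §1 proof of Lem. 1.1, §6] [cite: Weil1964, Chap. I n° 11, n° 29]
[cite: Liu2021, proof of Thm. 4.15; App. B Lem. B.9–B.10] -/
theorem doublingPairingTensorSeparation :
    ∀ (L : Type) [Field L] [NumberField L] [IsCMField L] (H : Matrix (Fin 2) (Fin 2) L)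
      (dV : Fin 2 → L) (hdV : ∀ i, IsCMField.complexConj L (dV i) = dV i) (hdV0 : ∀ i, dV i ≠ 0)
      (e₁ : Fin 2 × Fin 1 ≃ Fin 2) {n'' : ℕ} (e₂ : Fin (2 + 2) × Fin 1 ≃ Fin n'')
      (lam : Literature.NumberTheory.Automorphic.IdeleClassGroup L →ₜ* Circle) (hlam : IsConjugateSymplectic L lam)
      (μ : Measure (adelicGroupData (↥(maximalRealSubfield L)) L (IsCMField.complexConj L) 2 H).automorphicQuotient) [IsFiniteMeasure μ]
      (ιA : (adelicGroupData (↥(maximalRealSubfield L)) L (IsCMField.complexConj L) 2 H).Adelic →*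
        ↥(UnitaryGroup.adelic (↥(maximalRealSubfield L)) L (IsCMField.complexConj L) 2 (Matrix.diagonal dV)))
      (hιAc : Continuous ιA)
      (hιAr : ∀ ⦃γ : (adelicGroupData (↥(maximalRealSubfield L)) L (IsCMField.complexConj L) 2 H).Adelic⦄,
        γ ∈ (UnitaryGroup.toAdelic (↥(maximalRealSubfield L)) L (IsCMField.complexConj L) 2 H).range →
          ιA γ ∈ (UnitaryGroup.toAdelic (↥(maximalRealSubfield L)) L (IsCMField.complexConj L) 2 (Matrix.diagonal dV)).range)
      [CompactSpace (adelicGroupData (↥(maximalRealSubfield L)) L (IsCMField.complexConj L) 2 H).automorphicQuotient]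
      (w₁ w₂ : (adelicGroupData (↥(maximalRealSubfield L)) L (IsCMField.complexConj L) 2 H).automorphicQuotient → ℂ),
      Integrable w₁ μ → Integrable w₂ μ →
      (∃ (a' : (↥(maximalRealSubfield L))ˣ)
        (hρD : HasThetaMajorants fun
          (p : ↥(UnitaryGroup.adelic (↥(maximalRealSubfield L)) L (IsCMField.complexConj L) (2 + 2)
              (Matrix.diagonal (dD L e₁ dV hdV (fun _ : Fin 1 => (1 : L)) (fun _ => map_one _)))) ×
            ↥(UnitaryGroup.adelic (↥(maximalRealSubfield L)) L (IsCMField.complexConj L) 1 (JW (↥(maximalRealSubfield L)) L a')))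
          (Φ : piSchwartzBruhat (↥(maximalRealSubfield L)) (Fin n'')) =>
            pairRep (↥(maximalRealSubfield L)) L (IsCMField.complexConj L) (2 + 2) 1 e₂
              (Matrix.diagonal (dD L e₁ dV hdV (fun _ : Fin 1 => (1 : L)) (fun _ => map_one _))) (JW (↥(maximalRealSubfield L)) L a')
              (chiSplittingLine L e₂ (dD L e₁ dV hdV (fun _ : Fin 1 => (1 : L)) (fun _ => map_one _))
                (dD_conj L e₁ dV hdV (fun _ : Fin 1 => (1 : L)) (fun _ => map_one _))
                (dD_ne_zero L e₁ dV hdV (fun _ : Fin 1 => (1 : L)) (fun _ => map_one _) hdV0 (fun _ => one_ne_zero))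
                (toHeckeCharacter L lam⁻¹) (isUnitary_toHeckeCharacter L lam⁻¹)
                ((isOscillatorChar_toHeckeCharacter_iff lam⁻¹).mpr (K2LiuConjugateSymplecticInv.IsConjugateSymplectic.inv hlam)) (TW (↥(maximalRealSubfield L)) a')
                (isUnit_det_TW (↥(maximalRealSubfield L)) a') (JW (↥(maximalRealSubfield L)) L a') (JW_eq (↥(maximalRealSubfield L)) L a'))
              p Φ)
        (μW : @Measure (↥(UnitaryGroup.adelic (↥(maximalRealSubfield L)) L (IsCMField.complexConj L) 1 (JW (↥(maximalRealSubfield L)) L a')) ⧸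
          (UnitaryGroup.toAdelic (↥(maximalRealSubfield L)) L (IsCMField.complexConj L) 1 (JW (↥(maximalRealSubfield L)) L a')).range) (borel _))
        (_ : @IsFiniteMeasure _ (borel _) μW)
        (_ : @SMulInvariantMeasure
          ↥(UnitaryGroup.adelic (↥(maximalRealSubfield L)) L (IsCMField.complexConj L) 1 (JW (↥(maximalRealSubfield L)) L a'))
          (↥(UnitaryGroup.adelic (↥(maximalRealSubfield L)) L (IsCMField.complexConj L) 1 (JW (↥(maximalRealSubfield L)) L a')) ⧸
            (UnitaryGroup.toAdelic (↥(maximalRealSubfield L)) L (IsCMField.complexConj L) 1 (JW (↥(maximalRealSubfield L)) L a')).range)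
          _ (borel _) μW)
        (Φ' : piSchwartzBruhat (↥(maximalRealSubfield L)) (Fin n''))
        (f : C(↥(UnitaryGroup.adelic (↥(maximalRealSubfield L)) L (IsCMField.complexConj L) 1 (JW (↥(maximalRealSubfield L)) L a')) ⧸
          (UnitaryGroup.toAdelic (↥(maximalRealSubfield L)) L (IsCMField.complexConj L) 1 (JW (↥(maximalRealSubfield L)) L a')).range, ℂ)),
        doublingPairing (adelicGroupData (↥(maximalRealSubfield L)) L (IsCMField.complexConj L) 2 H) μ
          (toQuotFun₂ (adelicGroupData (↥(maximalRealSubfield L)) L (IsCMField.complexConj L) 2 H)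
            (fun g => @doubledLineThetaLift L _ _ _ 2 1 2 e₁ dV hdV (fun _ : Fin 1 => (1 : L)) (fun _ => map_one _) n'' e₂
              hdV0 (fun _ => one_ne_zero) lam⁻¹ (K2LiuConjugateSymplecticInv.IsConjugateSymplectic.inv hlam) a' hρD (borel _) μW Φ' f
              (iotaV L e₁ dV hdV (fun _ : Fin 1 => (1 : L)) (fun _ => map_one _) (ιA g.1, ιA g.2))))
          w₁ w₂ ≠ 0) →
      ∃ (a' : (↥(maximalRealSubfield L))ˣ)
        (hρD : HasThetaMajorants fun
          (p : ↥(UnitaryGroup.adelic (↥(maximalRealSubfield L)) L (IsCMField.complexConj L) (2 + 2)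
              (Matrix.diagonal (dD L e₁ dV hdV (fun _ : Fin 1 => (1 : L)) (fun _ => map_one _)))) ×
            ↥(UnitaryGroup.adelic (↥(maximalRealSubfield L)) L (IsCMField.complexConj L) 1 (JW (↥(maximalRealSubfield L)) L a')))
          (Φ : piSchwartzBruhat (↥(maximalRealSubfield L)) (Fin n'')) =>
            pairRep (↥(maximalRealSubfield L)) L (IsCMField.complexConj L) (2 + 2) 1 e₂
              (Matrix.diagonal (dD L e₁ dV hdV (fun _ : Fin 1 => (1 : L)) (fun _ => map_one _))) (JW (↥(maximalRealSubfield L)) L a')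
              (chiSplittingLine L e₂ (dD L e₁ dV hdV (fun _ : Fin 1 => (1 : L)) (fun _ => map_one _))
                (dD_conj L e₁ dV hdV (fun _ : Fin 1 => (1 : L)) (fun _ => map_one _))
                (dD_ne_zero L e₁ dV hdV (fun _ : Fin 1 => (1 : L)) (fun _ => map_one _) hdV0 (fun _ => one_ne_zero))
                (toHeckeCharacter L lam⁻¹) (isUnitary_toHeckeCharacter L lam⁻¹)
                ((isOscillatorChar_toHeckeCharacter_iff lam⁻¹).mpr (K2LiuConjugateSymplecticInv.IsConjugateSymplectic.inv hlam)) (TW (↥(maximalRealSubfield L)) a')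
                (isUnit_det_TW (↥(maximalRealSubfield L)) a') (JW (↥(maximalRealSubfield L)) L a') (JW_eq (↥(maximalRealSubfield L)) L a'))
              p Φ)
        (μW : @Measure (↥(UnitaryGroup.adelic (↥(maximalRealSubfield L)) L (IsCMField.complexConj L) 1 (JW (↥(maximalRealSubfield L)) L a')) ⧸
          (UnitaryGroup.toAdelic (↥(maximalRealSubfield L)) L (IsCMField.complexConj L) 1 (JW (↥(maximalRealSubfield L)) L a')).range) (borel _))
        (_ : @IsFiniteMeasure _ (borel _) μW)
        (_ : @SMulInvariantMeasure
          ↥(UnitaryGroup.adelic (↥(maximalRealSubfield L)) L (IsCMField.complexConj L) 1 (JW (↥(maximalRealSubfield L)) L a'))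
          (↥(UnitaryGroup.adelic (↥(maximalRealSubfield L)) L (IsCMField.complexConj L) 1 (JW (↥(maximalRealSubfield L)) L a')) ⧸
            (UnitaryGroup.toAdelic (↥(maximalRealSubfield L)) L (IsCMField.complexConj L) 1 (JW (↥(maximalRealSubfield L)) L a')).range)
          _ (borel _) μW)
        (Φ' : piSchwartzBruhat (↥(maximalRealSubfield L)) (Fin n''))
        (_ : Φ' ∈ Submodule.span ℂ (Set.range fun p : ↥(piSchwartzBruhat (↥(maximalRealSubfield L)) (Fin 2)) × ↥(piSchwartzBruhat (↥(maximalRealSubfield L)) (Fin 2)) =>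
          Literature.NumberTheory.Weil1964.sumTensor (↥(maximalRealSubfield L)) (Literature.NumberTheory.GelbartRogawski1991.GRConstruction.idxSplit e₂ e₁ e₁) p.1 p.2))
        (f : C(↥(UnitaryGroup.adelic (↥(maximalRealSubfield L)) L (IsCMField.complexConj L) 1 (JW (↥(maximalRealSubfield L)) L a')) ⧸
          (UnitaryGroup.toAdelic (↥(maximalRealSubfield L)) L (IsCMField.complexConj L) 1 (JW (↥(maximalRealSubfield L)) L a')).range, ℂ)),
        doublingPairing (adelicGroupData (↥(maximalRealSubfield L)) L (IsCMField.complexConj L) 2 H) μ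
          (toQuotFun₂ (adelicGroupData (↥(maximalRealSubfield L)) L (IsCMField.complexConj L) 2 H)
            (fun g => @doubledLineThetaLift L _ _ _ 2 1 2 e₁ dV hdV (fun _ : Fin 1 => (1 : L)) (fun _ => map_one _) n'' e₂
              hdV0 (fun _ => one_ne_zero) lam⁻¹ (K2LiuConjugateSymplecticInv.IsConjugateSymplectic.inv hlam) a' hρD (borel _) μW Φ' f
              (iotaV L e₁ dV hdV (fun _ : Fin 1 => (1 : L)) (fun _ => map_one _) (ιA g.1, ιA g.2))))
          w₁ w₂ ≠ 0 := by
  intro L _ _ _ H dV hdV hdV0 e₁ n'' e₂ lam hlam μ _ ιA hιAc hιAr _ w₁ w₂ hw₁ hw₂ hhyp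
  obtain ⟨a', hρD, μW, hfin, hinv, Φ', f, hne⟩ := hhyp
  letI iA : MeasurableSpace (↥(UnitaryGroup.adelic (Fp L) L (IsCMField.complexConj L) 1 (JW (Fp L) L a')) ⧸ (UnitaryGroup.toAdelic (Fp L) L (IsCMField.complexConj L) 1 (JW (Fp L) L a')).range) := borel _
  haveI : BorelSpace (↥(UnitaryGroup.adelic (Fp L) L (IsCMField.complexConj L) 1 (JW (Fp L) L a')) ⧸ (UnitaryGroup.toAdelic (Fp L) L (IsCMField.complexConj L) 1 (JW (Fp L) L a')).range) := ⟨rfl⟩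
  haveI := hfin
  -- the pairing as a `ℂ`-linear functional of `Φ`
  obtain ⟨hadd, hsmul⟩ := doublingPairing_doubledLineThetaLift_add_smul L e₁ H dV hdV (fun _ : Fin 1 => (1 : L)) (fun _ => map_one _) e₂ hdV0
    (fun _ => one_ne_zero) lam⁻¹ (K2LiuConjugateSymplecticInv.IsConjugateSymplectic.inv hlam) a' hρD ιA hιAc hιAr μW f μ hw₁ hw₂
  let ℓ : piSchwartzBruhat (Fp L) (Fin n'') →ₗ[ℂ] ℂ :=
    { toFun := fun Φ => doublingPairing (adelicGroupData (Fp L) L (IsCMField.complexConj L) 2 H) μ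
        (toQuotFun₂ (adelicGroupData (Fp L) L (IsCMField.complexConj L) 2 H)
          (fun g => doubledLineThetaLift L e₁ dV hdV (fun _ : Fin 1 => (1 : L)) (fun _ => map_one _) e₂ hdV0 (fun _ => one_ne_zero) lam⁻¹
            (K2LiuConjugateSymplecticInv.IsConjugateSymplectic.inv hlam) a' hρD μW Φ f
            (iotaV L e₁ dV hdV (fun _ : Fin 1 => (1 : L)) (fun _ => map_one _) (ιA g.1, ιA g.2)))) w₁ w₂,
      map_add' := hadd, map_smul' := hsmul }
  have hℓ : ∀ Φ, ℓ Φ = doublingPairing (adelicGroupData (Fp L) L (IsCMField.complexConj L) 2 H) μ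
      (toQuotFun₂ (adelicGroupData (Fp L) L (IsCMField.complexConj L) 2 H)
        (fun g => doubledLineThetaLift L e₁ dV hdV (fun _ : Fin 1 => (1 : L)) (fun _ => map_one _) e₂ hdV0 (fun _ => one_ne_zero) lam⁻¹
          (K2LiuConjugateSymplecticInv.IsConjugateSymplectic.inv hlam) a' hρD μW Φ f
          (iotaV L e₁ dV hdV (fun _ : Fin 1 => (1 : L)) (fun _ => map_one _) (ιA g.1, ιA g.2)))) w₁ w₂ := fun _ => rfl
  -- continuity on every archimedean slot, density of the pure tensors there, hence a pure tensor with non-zero pairing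
  have hcont : ∀ Φf : FinSB (Fp L) (Fin n''),
      Continuous fun φ : 𝓢((Fin n'' → mixedSpace (Fp L)), ℂ) => ℓ (piSchwartzBruhatEquiv (Fp L) (Fin n'') (φ ⊗ₜ[ℂ] Φf)) := fun Φf =>
    continuous_doublingPairing_doubledLineThetaLift_tmul L e₁ H dV hdV (fun _ : Fin 1 => (1 : L)) (fun _ => map_one _) e₂ hdV0 (fun _ => one_ne_zero)
      lam⁻¹ (K2LiuConjugateSymplecticInv.IsConjugateSymplectic.inv hlam) a' hρD ιA hιAc hιAr μW f μ hw₁ hw₂ Φf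
  have hΦ' : ℓ Φ' ≠ 0 := by rw [hℓ]; exact hne
  obtain ⟨Φ₁, Φ₂, h12⟩ := exists_sumTensor_ne_zero (Literature.NumberTheory.GelbartRogawski1991.GRConstruction.idxSplit e₂ e₁ e₁)
    (dense_span_archBoxTensor (Fp L) (Fin 2) (Fin 2)) ℓ hcont hΦ'
  rw [hℓ] at h12
  exact ⟨a', hρD, μW, hfin, hinv, _, Submodule.subset_span ⟨(Φ₁, Φ₂), rfl⟩, f, h12⟩

end Summit.HodgeConjecture.HodgeConjecture.Cruxes.HLiu418.K2LiuDoublingPairingTensorSeparation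

end
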